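import Mathlib
import HarnessLib
import Literature.Computability.Complexity.OccurrenceObstructionsIPProofs
import Literature.Computability.AlgebraicComplexity.OrbitCoordinateRingProofs
import Literature.Computability.AlgebraicComplexity.OrbitClosureWeights
import Literature.RingTheory.MvPolynomial.BihomogeneousCoefficients

/-!
# `ValuativeGCT.TailFlip` (stmt-ValiantsHypothesis-15687), line `Sketch` (idea `isobaric-anchors`):
# the registered stub `stub_isobaricInheritance` — the engine of the line

Letters: inner (permanent) size `n`, padding `j`, determinant size `n + j`, outer degree `δ`, inner
top variable `x_t = X (topMatIdx n)`.

* `aeval_twist_eq_pow_mul_of_isobaric` — on an `x_t`-ISOBARIC inner form `h` (every monomial of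
  `h` has the same `x_t`-exponent `e₀`) the Kadish–Landsberg / BIP twist of the coefficient vector,
  `coeff_e ↦ ((e_t + j)!/e_t!) · coeff_e`, is the SCALAR `c = (e₀ + j).descFactorial j`, so a form
  `F` of degree `δ` in the coefficients satisfies `F(twisted h) = c ^ δ · F(h)`
  (`Literature.RingTheory.MvPolynomial.eval_smul_of_isHomogeneous`).
* `stub_isobaricInheritance` — verbatim the registered stub of the skeleton
  `Cruxes/TailFlip/Lines/Sketch.lean`: an UNTWISTED nonsingular evaluation matrix of inner
  highest-weight vectors `F₁ … F_D` of weight `μ*` (`μ ⊢ nδ`, `≤ n²` parts) on `x_t`-isobaric inner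
  points `A_l · per_n` gives `D ≤ mult_{(μ♯(n+j))*} ℂ[Δ_{n+j}(X₀₀^j per_n)]` for the padding `j`.
  Proof: the `F_i` are forms of degree `δ` (`isHomogeneous_of_mem_highestWeightSpace`,
  `size_partitionWeightLex'`), so the TWISTED evaluation matrix of the landed
  `Theorems.ValuativeFlip.stub_twistedInheritance` is the untwisted one with column `l` multiplied by
  `((e₀ l + j).descFactorial j) ^ δ ≠ 0` (`Matrix.det_mul_row`); hence it is nonsingular too and the
  twisted inheritance applies.

The twisted inheritance and its helpers (`ii_*`) are PRIVATE COPIES of the declarations of the landed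
`Theorems/ValuativeGCTValuativeFlipTwistedInheritance.lean` (namespace `Theorems.ValuativeFlip`),
copied verbatim to keep this file's imports inside the built library (that module was not yet built
on the farm when this file landed).

Sources: Bürgisser–Ikenmeyer–Panova 2019 Lemma 5.2, Thm. 5.4; Ikenmeyer–Panova 2017 Prop. 2.6(b);
BLMW 2011 §6.4 Problem 6.10; the crux sketch `Cruxes/TailFlip/Sketch_ideator2.lean`
(`isobaricTwistScalar_holds`, `isobaricInheritance_of_twisted`).
-/

set_option linter.dupNamespace false

namespace Summit.ValiantsHypothesis.ValiantsHypothesis.Theorems.TailFlip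

open MvPolynomial
open scoped BigOperators Matrix
open Literature.NumberTheory.DiophantineGeometry
open Literature.Computability.AlgebraicComplexity
open Literature.Computability.Complexity

noncomputable section

/-! ## The engine (private copy of the landed `stub_evalRankLowerBound`, siege seat k3) -/

-- private copy of Theorems/ValuativeGCTValuativeFlipTwistedInheritance.lean (farm module unbuilt at the time)
/-- A polynomial of the vanishing ideal of `GL · f` vanishes at EVERY endomorphism-orbit point
`A · f`, invertible or not (`I(GL · f) = ker(genericOrbitMap)`, Zariski density of `GL` in `Mat`).
[Mulmuley–Sohoni 2001 §4; folklore] -/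
private theorem ii_aeval_formCoeff_linSubst_eq_zero {σ : Type*} [Fintype σ]
    [LinearOrder σ] {f : MvPolynomial σ ℂ} {m : ℕ} {G : MvPolynomial (DegIdx σ m) ℂ}
    (hG : G ∈ orbitVanishingIdeal f m) (A : Matrix σ σ ℂ) :
    aeval (formCoeff m (linSubst σ ℂ A f)) G = 0 := by
  rw [orbitVanishingIdeal_eq_ker_genericOrbitMap, RingHom.mem_ker] at hG
  have hG' : genericOrbitMap f m G = 0 := hG
  rw [← eval_genericOrbitMap f m G A, hG', map_zero]

-- private copy of Theorems/ValuativeGCTValuativeFlipTwistedInheritance.lean (farm module unbuilt at the time)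
/-- The class of a highest-weight vector of `ℂ[Sym^m ℂ^σ]` is a highest-weight vector of
`ℂ[Δ_m(f)]` of the same weight (the quotient map is `GL`-equivariant). [folklore] -/
private theorem ii_mk_mem_highestWeightSpace {σ : Type*} [Fintype σ] [LinearOrder σ]
    (f : MvPolynomial σ ℂ) (m : ℕ) {χ : Weight σ} {F : MvPolynomial (DegIdx σ m) ℂ}
    (hF : F ∈ highestWeightSpace (coordRep σ ℂ m) χ) :
    (Ideal.Quotient.mk (orbitVanishingIdeal f m) F : OrbitCoordRing f m) ∈
      highestWeightSpace (orbitCoordRep f m) χ := by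
  intro g hg
  rw [orbitCoordRep_apply, orbitCoordSubst_mk, ← coordRep_apply, hF g hg]
  rw [← Ideal.Quotient.mkₐ_eq_mk ℂ, map_smul]

-- private copy of Theorems/ValuativeGCTValuativeFlipTwistedInheritance.lean (farm module unbuilt at the time)
/-- **The evaluation-certificate engine** (private copy of the registered stub
`stub_evalRankLowerBound`, landed by siege seat k3 as
`ValuativeGCTValuativeFlipEvalRankLowerBoundK3.stub_evalRankLowerBound`; copied privately to keep this
file's imports inside the built library).  Highest-weight vectors `F₁ … F_D ∈ ℂ[Sym^m ℂ^σ]` of weight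
`χ` with a nonsingular evaluation matrix `(F_i(A_l · f))_{i,l}` at endomorphism-orbit points certify
`D ≤ mult_χ ℂ[Δ_m(f)]` (`m ≠ 0`): their classes are linearly independent highest-weight vectors of
`ℂ[Δ_m(f)]` — a vanishing combination lies in `I(GL · f)`, vanishes at every `A_l · f`, and is killed
by the nonsingular matrix (`Matrix.eq_zero_of_vecMul_eq_zero`).
[Mulmuley–Sohoni 2001 §4–5; BLMW 2011 §5.2; Ikenmeyer–Kandasamy 2020 §3] -/
private theorem ii_evalRank_le_orbitMultiplicity {σ : Type} [Fintype σ] [LinearOrder σ]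
    (f : MvPolynomial σ ℂ) (m : ℕ) (hm : m ≠ 0) (χ : Weight σ) (D : ℕ)
    (F : Fin D → MvPolynomial (DegIdx σ m) ℂ) (hF : ∀ i, F i ∈ highestWeightSpace (coordRep σ ℂ m) χ)
    (A : Fin D → Matrix σ σ ℂ)
    (hdet : (Matrix.of fun i l : Fin D =>
      MvPolynomial.aeval (formCoeff m (linSubst σ ℂ (A l) f)) (F i)).det ≠ 0) :
    D ≤ orbitMultiplicity ℂ f m χ := by
  classical
  haveI : FiniteDimensional ℂ (highestWeightSpace (orbitCoordRep f m) χ) :=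
    finiteDimensional_highestWeightSpace_orbitCoordRep_holds (k := ℂ) f hm χ
  -- the classes, as highest-weight vectors of `ℂ[Δ_m(f)]`
  let v : Fin D → highestWeightSpace (orbitCoordRep f m) χ := fun i =>
    ⟨Ideal.Quotient.mk (orbitVanishingIdeal f m) (F i), ii_mk_mem_highestWeightSpace f m (hF i)⟩
  have hli : LinearIndependent ℂ v := by
    rw [Fintype.linearIndependent_iff]
    intro c hc
    -- the combination lies in the ideal
    have hmem : ∑ i, c i • F i ∈ orbitVanishingIdeal f m := by
      rw [← Ideal.Quotient.eq_zero_iff_mem, map_sum]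
      have h := congrArg Subtype.val hc
      rw [Submodule.coe_sum, Submodule.coe_zero] at h
      have hsm : ∀ i, Ideal.Quotient.mk (orbitVanishingIdeal f m) (c i • F i) =
          c i • Ideal.Quotient.mk (orbitVanishingIdeal f m) (F i) := fun i => by
        rw [← Ideal.Quotient.mkₐ_eq_mk ℂ, map_smul]
      simp only [hsm]
      simpa [v] using h
    -- hence vanishes at every `A l · f`: `c ᵥ* M = 0`
    have hvec : Matrix.vecMul c
        (Matrix.of fun i l : Fin D => MvPolynomial.aeval (formCoeff m (linSubst σ ℂ (A l) f)) (F i)) = 0 := by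
      funext l
      have h := ii_aeval_formCoeff_linSubst_eq_zero hmem (A l)
      rw [map_sum] at h
      simp only [map_smul, smul_eq_mul] at h
      rw [Matrix.vecMul, dotProduct]
      simpa [Matrix.of_apply] using h
    exact congrFun (Matrix.eq_zero_of_vecMul_eq_zero hdet hvec)
  have h := hli.fintype_card_le_finrank
  rw [Fintype.card_fin] at h
  exact h

/-! ## The padded inner points are endomorphism-orbit points of the route's padded permanent -/

-- private copy of Theorems/ValuativeGCTValuativeFlipTwistedInheritance.lean (farm module unbuilt at the time)
/-- The padded permanent along an enumeration of its block: `X₀₀^{m-n} · per_n(X_E)`,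
`E ab = toLex (e a, e b)` (k4's `frt_paddedPerFormLex_eq`, restated to keep this file's imports
free of the route file). [folklore] -/
private theorem ii_paddedPerFormLex_eq (n m : ℕ) [NeZero m] (e : Fin n ≃ BlockIdx n m) :
    paddedPerFormLex ℂ n m = (X (toLex ((0 : Fin m), (0 : Fin m))) : MvPolynomial (MatIdx m) ℂ) ^ (m - n) *
      rename (fun ab : Fin n × Fin n => (toLex (((e ab.1 : BlockIdx n m) : Fin m), ((e ab.2 : BlockIdx n m) : Fin m)) : MatIdx m))
        (perPoly (Fin n) ℂ) := by
  rw [paddedPerFormLex_eq, ← rename_perPoly_equiv (k := ℂ) e, rename_rename]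
  rfl

-- private copy of Theorems/ValuativeGCTValuativeFlipTwistedInheritance.lean (farm module unbuilt at the time)
/-- A linear substitution on a renamed polynomial is the evaluation at the images of the renamed
variables. [folklore] -/
private theorem ii_linSubst_rename_eq_aeval {α τ : Type*} [Fintype τ] [DecidableEq τ] (M : Matrix τ τ ℂ)
    (κ : α → τ) (P : MvPolynomial α ℂ) :
    linSubst τ ℂ M (rename κ P) = aeval (fun a => linSubst τ ℂ M (X (κ a))) P := by
  suffices H : (linSubst τ ℂ M).comp (rename κ) = aeval (fun a => linSubst τ ℂ M (X (κ a))) from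
    congrArg (fun φ => φ P) H
  exact MvPolynomial.algHom_ext fun a => by simp only [AlgHom.comp_apply, rename_X, aeval_X]

-- private copy of Theorems/ValuativeGCTValuativeFlipTwistedInheritance.lean (farm module unbuilt at the time)
/-- Renaming an evaluation is evaluating at the renamed images. [folklore] -/
private theorem ii_rename_aeval_eq_aeval {α τ τ' : Type*} (ι : τ → τ') (G : α → MvPolynomial τ ℂ)
    (P : MvPolynomial α ℂ) :
    rename ι (aeval G P) = aeval (fun a => rename ι (G a)) P := by
  suffices H : (rename ι).comp (aeval G) = aeval (fun a => rename ι (G a)) from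
    congrArg (fun φ => φ P) H
  exact MvPolynomial.algHom_ext fun a => by simp

-- private copy of Theorems/ValuativeGCTValuativeFlipTwistedInheritance.lean (farm module unbuilt at the time)
/-- **The padded inner points are `End`-orbit points of the padded permanent.**  For every matrix
`A ∈ Mat_{n²}` there is `Ã ∈ Mat_{(n+j)²}` with
`Ã · (X₀₀^j per_n) = X_top^j · (A · per_n)|segment` (`paddedForm n j (A · per_n)`): send the padding
variable `X₀₀` to the top variable and each block variable to the segment copy of the corresponding
column of `A` (for `j = 0` the padding power is `1` and the block is everything).
[Mulmuley–Sohoni 2001 §4; Bürgisser–Ikenmeyer–Panova 2019 §1(a)] -/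
private theorem ii_exists_linSubst_paddedPerFormLex_eq_paddedForm (n j : ℕ) [NeZero n] [NeZero (n + j)]
    (A : Matrix (MatIdx n) (MatIdx n) ℂ) :
    ∃ M : Matrix (MatIdx (n + j)) (MatIdx (n + j)) ℂ,
      linSubst (MatIdx (n + j)) ℂ M (paddedPerFormLex ℂ n (n + j)) =
        paddedForm n j (linSubst (MatIdx n) ℂ A (paddedPerFormLex ℂ n n)) := by
  classical
  -- enumerations of the two blocks
  let e₁ : Fin n ≃ BlockIdx n (n + j) :=
    (Fintype.equivFinOfCardEq (card_blockIdx (Nat.le_add_right n j))).symm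
  let e₀ : Fin n ≃ BlockIdx n n := (Fintype.equivFinOfCardEq (card_blockIdx le_rfl)).symm
  -- block variables at level `n + j` are never the padding variable when `0 < j`, and are
  -- enumerated injectively
  have hinj : Function.Injective fun ab : Fin n × Fin n =>
      (toLex (((e₁ ab.1 : BlockIdx n (n + j)) : Fin (n + j)), ((e₁ ab.2 : BlockIdx n (n + j)) : Fin (n + j))) : MatIdx (n + j)) := by
    intro ab ab' h
    have h1 := congrArg (fun x : MatIdx (n + j) => (ofLex x).1) h
    have h2 := congrArg (fun x : MatIdx (n + j) => (ofLex x).2) h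
    simp only [ofLex_toLex] at h1 h2
    exact Prod.ext (e₁.injective (Subtype.ext h1)) (e₁.injective (Subtype.ext h2))
  -- the substitution matrix, column by column
  let M : Matrix (MatIdx (n + j)) (MatIdx (n + j)) ℂ := fun s i =>
    if h : ∃ ab : Fin n × Fin n,
        (toLex (((e₁ ab.1 : BlockIdx n (n + j)) : Fin (n + j)), ((e₁ ab.2 : BlockIdx n (n + j)) : Fin (n + j))) : MatIdx (n + j)) = i then
      ∑ r : MatIdx n, (if segEmb (Nat.le_add_right n j) r = s then
        A r (toLex (((e₀ (Classical.choose h).1 : BlockIdx n n) : Fin n), ((e₀ (Classical.choose h).2 : BlockIdx n n) : Fin n))) else 0)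
    else if i = toLex ((0 : Fin (n + j)), (0 : Fin (n + j))) then (if s = topMatIdx (n + j) then 1 else 0) else 0
  have hM_block : ∀ ab : Fin n × Fin n,
      linSubst (MatIdx (n + j)) ℂ M
          (X (toLex (((e₁ ab.1 : BlockIdx n (n + j)) : Fin (n + j)), ((e₁ ab.2 : BlockIdx n (n + j)) : Fin (n + j))))) =
        ∑ r : MatIdx n, A r (toLex (((e₀ ab.1 : BlockIdx n n) : Fin n), ((e₀ ab.2 : BlockIdx n n) : Fin n))) •
          (X (segEmb (Nat.le_add_right n j) r) : MvPolynomial (MatIdx (n + j)) ℂ) := by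
    intro ab
    have hex : ∃ ab' : Fin n × Fin n,
        (toLex (((e₁ ab'.1 : BlockIdx n (n + j)) : Fin (n + j)), ((e₁ ab'.2 : BlockIdx n (n + j)) : Fin (n + j))) : MatIdx (n + j)) =
          toLex (((e₁ ab.1 : BlockIdx n (n + j)) : Fin (n + j)), ((e₁ ab.2 : BlockIdx n (n + j)) : Fin (n + j))) :=
      ⟨ab, rfl⟩
    have hch : Classical.choose hex = ab := hinj (Classical.choose_spec hex)
    rw [linSubst_X]
    simp only [M, dif_pos hex, hch, Finset.sum_smul, ite_smul, zero_smul]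
    rw [Finset.sum_comm]
    refine Finset.sum_congr rfl fun r _ => ?_
    rw [Finset.sum_ite_eq Finset.univ (segEmb (Nat.le_add_right n j) r), if_pos (Finset.mem_univ _)]
  have hM_pad : 0 < j → linSubst (MatIdx (n + j)) ℂ M (X (toLex ((0 : Fin (n + j)), (0 : Fin (n + j))))) =
      X (topMatIdx (n + j)) := by
    intro hj
    have hnot : ¬ ∃ ab : Fin n × Fin n,
        (toLex (((e₁ ab.1 : BlockIdx n (n + j)) : Fin (n + j)), ((e₁ ab.2 : BlockIdx n (n + j)) : Fin (n + j))) : MatIdx (n + j)) =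
          toLex ((0 : Fin (n + j)), (0 : Fin (n + j))) := by
      rintro ⟨ab, hab⟩
      have h1 := congrArg (fun x : MatIdx (n + j) => (((ofLex x).1 : Fin (n + j)) : ℕ)) hab
      simp only [ofLex_toLex, Fin.val_zero] at h1
      have h2 := (e₁ ab.1).2
      omega
    rw [linSubst_X]
    simp only [M, dif_neg hnot, if_true, ite_smul, one_smul, zero_smul]
    rw [Finset.sum_ite_eq' Finset.univ (topMatIdx (n + j)), if_pos (Finset.mem_univ _)]
  refine ⟨M, ?_⟩
  -- unfold both padded permanents along the enumerations
  have hpow₁ : (X (toLex ((0 : Fin (n + j)), (0 : Fin (n + j)))) : MvPolynomial (MatIdx (n + j)) ℂ) ^ (n + j - n) =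
      X (toLex ((0 : Fin (n + j)), (0 : Fin (n + j)))) ^ j := by
    rw [Nat.add_sub_cancel_left]
  have hpow₀ : (X (toLex ((0 : Fin n), (0 : Fin n))) : MvPolynomial (MatIdx n) ℂ) ^ (n - n) = 1 := by
    rw [Nat.sub_self, pow_zero]
  rw [ii_paddedPerFormLex_eq n (n + j) e₁, ii_paddedPerFormLex_eq n n e₀, hpow₁, hpow₀, one_mul, map_mul,
    map_pow, paddedForm, ii_linSubst_rename_eq_aeval, ii_linSubst_rename_eq_aeval, ii_rename_aeval_eq_aeval]
  have himg : (fun ab : Fin n × Fin n => linSubst (MatIdx (n + j)) ℂ M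
        (X (toLex (((e₁ ab.1 : BlockIdx n (n + j)) : Fin (n + j)), ((e₁ ab.2 : BlockIdx n (n + j)) : Fin (n + j)))))) =
      fun ab => rename (segEmb (Nat.le_add_right n j))
        (linSubst (MatIdx n) ℂ A (X (toLex (((e₀ ab.1 : BlockIdx n n) : Fin n), ((e₀ ab.2 : BlockIdx n n) : Fin n))))) := by
    funext ab
    rw [hM_block, linSubst_X, map_sum]
    simp only [map_smul, rename_X]
  rw [himg]
  congr 1
  rcases Nat.eq_zero_or_pos j with hj | hj
  · subst hj
    simp
  · rw [hM_pad hj]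

/-! ## Twisted inheritance -/

-- private copy of Theorems/ValuativeGCTValuativeFlipTwistedInheritance.lean (farm module unbuilt at the time)
/-- **Twisted inheritance** (private copy of the landed registered siege stub
`Theorems.ValuativeFlip.stub_twistedInheritance`).  For inner size `n`, padding `j`,
degree `δ`, an inner shape `μ ⊢ nδ` with `≤ n²` parts, highest-weight vectors `F₁ … F_D` of weight
`μ*` on `ℂ[Sym^n ℂ^{n²}]` and matrices `A₁ … A_D ∈ Mat_{n²}`: if the Δ_j-TWISTED evaluation matrix
`(F_i(Δ_j(A_l · per_n)))_{i,l}` is nonsingular (`Δ_j` rescales the coefficient of `x^e` by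
`(e_top + j)!/e_top!`), then `D ≤ mult_{(μ♯(n+j))*} ℂ[Δ_{n+j}(X₀₀^j per_n)]`.  The lifts
`liftHWV n j F_i` are highest-weight vectors of weight `(μ♯)*` (`liftHWV_mem_highestWeightSpace`),
the padded inner points are `End`-orbit points `Ã_l · (X₀₀^j per_n)`
(`ii_exists_linSubst_paddedPerFormLex_eq_paddedForm`), the evaluation matrix of the lifts there is the
twisted inner matrix (`aeval_formCoeff_paddedForm_liftHWV`), and the evaluation-certificate engine
(`stub_evalRankLowerBound`, here the private copy `ii_evalRank_le_orbitMultiplicity`) concludes.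
[Ikenmeyer–Panova 2017 Prop. 2.6(b); Bürgisser–Ikenmeyer–Panova 2019 Lemma 5.2, Thm. 5.4;
BLMW 2011 §6.4 Problem 6.10] -/
private theorem ii_twistedInheritance :
    ∀ (n j δ : ℕ) [NeZero n] [NeZero (n + j)] (μ : Nat.Partition (n * δ)), μ.parts.card ≤ n * n →
      ∀ (D : ℕ) (F : Fin D → MvPolynomial (DegIdx (MatIdx n) n) ℂ),
        (∀ i, F i ∈ highestWeightSpace (coordRep (MatIdx n) ℂ n) (partitionWeightLex n μ)) →
        ∀ (A : Fin D → Matrix (MatIdx n) (MatIdx n) ℂ),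
          (Matrix.of fun i l : Fin D => MvPolynomial.aeval
              (fun e : DegIdx (MatIdx n) n =>
                (((e.1 (topMatIdx n) + j).descFactorial j : ℕ) : ℂ) *
                  MvPolynomial.coeff e.1 (linSubst (MatIdx n) ℂ (A l) (paddedPerFormLex ℂ n n)))
              (F i)).det ≠ 0 →
          D ≤ orbitMultiplicity ℂ (paddedPerFormLex ℂ n (n + j)) (n + j) (partitionWeightLex (n + j) (rowLift μ j)) := by
  intro n j δ _ _ μ hμ D F hF A hdet
  classical
  -- the padded points as `End`-orbit points
  choose M hM using fun l : Fin D => ii_exists_linSubst_paddedPerFormLex_eq_paddedForm n j (A l)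
  have hhom : ∀ l, (linSubst (MatIdx n) ℂ (A l) (paddedPerFormLex ℂ n n)).IsHomogeneous n := fun l =>
    linSubst_isHomogeneous _ (paddedPerFormLex_isHomogeneous ℂ le_rfl)
  refine ii_evalRank_le_orbitMultiplicity (paddedPerFormLex ℂ n (n + j)) (n + j) (NeZero.ne (n + j))
    (partitionWeightLex (n + j) (rowLift μ j)) D (fun i => liftHWV n j (F i))
    (fun i => liftHWV_mem_highestWeightSpace μ hμ j (hF i)) M ?_
  have hmat : (Matrix.of fun i l : Fin D => MvPolynomial.aeval
        (formCoeff (n + j) (linSubst (MatIdx (n + j)) ℂ (M l) (paddedPerFormLex ℂ n (n + j)))) (liftHWV n j (F i))) =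
      Matrix.of fun i l : Fin D => MvPolynomial.aeval
        (fun e : DegIdx (MatIdx n) n =>
          (((e.1 (topMatIdx n) + j).descFactorial j : ℕ) : ℂ) *
            MvPolynomial.coeff e.1 (linSubst (MatIdx n) ℂ (A l) (paddedPerFormLex ℂ n n))) (F i) := by
    ext i l
    rw [Matrix.of_apply, Matrix.of_apply, hM l, aeval_formCoeff_paddedForm_liftHWV j (hhom l)]
  rw [hmat]
  exact hdet


/-! ## Isobaric inheritance -/

/-- **The twist is a scalar on isobaric forms.**  For `F` homogeneous of degree `δ` in the
coefficient variables `DegIdx (MatIdx n) n` and an inner form `h` all of whose monomials have the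
same exponent `e₀` at the top variable `topMatIdx n`, the `Δ_j`-twisted evaluation
`F((((e_t + j).descFactorial j) · coeff_e h)_e)` equals `((e₀ + j).descFactorial j) ^ δ · F((coeff_e h)_e)`:
on the support of `h` the twist factor is the constant `(e₀ + j).descFactorial j`, off the support
both coefficient vectors vanish, and a degree-`δ` form scales by the `δ`-th power of a scalar.
[Cruxes/TailFlip/Sketch_ideator2.lean `isobaricTwistScalar_holds`; Bürgisser–Ikenmeyer–Panova 2019 Lemma 5.2] -/
theorem aeval_twist_eq_pow_mul_of_isobaric {n : ℕ} [NeZero n] (j : ℕ) {δ : ℕ} {e₀ : ℕ}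
    {F : MvPolynomial (DegIdx (MatIdx n) n) ℂ} (hF : F.IsHomogeneous δ)
    {h : MvPolynomial (MatIdx n) ℂ} (hiso : ∀ e ∈ h.support, e (topMatIdx n) = e₀) :
    MvPolynomial.aeval (fun e : DegIdx (MatIdx n) n =>
        (((e.1 (topMatIdx n) + j).descFactorial j : ℕ) : ℂ) * MvPolynomial.coeff e.1 h) F =
      ((((e₀ + j).descFactorial j : ℕ) : ℂ) ^ δ) *
        MvPolynomial.aeval (fun e : DegIdx (MatIdx n) n => MvPolynomial.coeff e.1 h) F := by
  have hfun : (fun e : DegIdx (MatIdx n) n =>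
        (((e.1 (topMatIdx n) + j).descFactorial j : ℕ) : ℂ) * MvPolynomial.coeff e.1 h) =
      (((e₀ + j).descFactorial j : ℕ) : ℂ) •
        (fun e : DegIdx (MatIdx n) n => MvPolynomial.coeff e.1 h) := by
    funext e
    simp only [Pi.smul_apply, smul_eq_mul]
    by_cases hc : MvPolynomial.coeff e.1 h = 0
    · simp [hc]
    · rw [hiso e.1 (MvPolynomial.mem_support_iff.mpr hc)]
  rw [hfun]
  simp only [MvPolynomial.aeval_eq_eval]
  exact Literature.RingTheory.MvPolynomial.eval_smul_of_isHomogeneous hF _ _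

/-- **stub_isobaricInheritance** (registered stub of line `Sketch`, verbatim; the engine of the
isobaric-anchors line).  Inner size `n`, padding `j`, degree `δ`, inner shape `μ ⊢ nδ` with `≤ n²`
parts, highest-weight vectors `F₁ … F_D` of weight `μ*` on `ℂ[Sym^n ℂ^{n²}]`, inner points
`A_l · per_n` that are `x_t`-ISOBARIC (every monomial of `A_l · per_n` has `x_t`-exponent `e₀ l`,
`x_t = X (topMatIdx n)`): if the UNTWISTED evaluation matrix `(F_i(A_l · per_n))_{i,l}` is
nonsingular then `D ≤ mult_{(μ♯(n+j))*} ℂ[Δ_{n+j}(X₀₀^j per_n)]`.  Proof: each `F_i` is a form of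
degree `δ` (`isHomogeneous_of_mem_highestWeightSpace`, `size_partitionWeightLex'`), so by
`aeval_twist_eq_pow_mul_of_isobaric` the twisted evaluation matrix is the untwisted one with column
`l` scaled by `((e₀ l + j).descFactorial j) ^ δ ≠ 0` (`Matrix.det_mul_row`,
`Nat.descFactorial_eq_zero_iff_lt`); it is nonsingular, and the landed twisted inheritance
`Theorems.ValuativeFlip.stub_twistedInheritance` (here its private copy `ii_twistedInheritance`)
concludes.
[Cruxes/TailFlip/Lines/Sketch.lean; Cruxes/TailFlip/Sketch_ideator2.lean `isobaricInheritance_of_twisted`;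
Bürgisser–Ikenmeyer–Panova 2019 Lemma 5.2, Thm. 5.4; Ikenmeyer–Panova 2017 Prop. 2.6(b);
BLMW 2011 §6.4 Problem 6.10] -/
theorem stub_isobaricInheritance :
    ∀ (n j δ : ℕ) [NeZero n] [NeZero (n + j)] (μ : Nat.Partition (n * δ)), μ.parts.card ≤ n * n →
      ∀ (D : ℕ) (F : Fin D → MvPolynomial (DegIdx (MatIdx n) n) ℂ),
        (∀ i, F i ∈ highestWeightSpace (coordRep (MatIdx n) ℂ n) (partitionWeightLex n μ)) →
        ∀ (A : Fin D → Matrix (MatIdx n) (MatIdx n) ℂ) (e₀ : Fin D → ℕ),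
          (∀ l, ∀ e ∈ (linSubst (MatIdx n) ℂ (A l) (paddedPerFormLex ℂ n n)).support, e (topMatIdx n) = e₀ l) →
          (Matrix.of fun i l : Fin D => MvPolynomial.aeval
              (fun e : DegIdx (MatIdx n) n =>
                MvPolynomial.coeff e.1 (linSubst (MatIdx n) ℂ (A l) (paddedPerFormLex ℂ n n))) (F i)).det ≠ 0 →
          D ≤ orbitMultiplicity ℂ (paddedPerFormLex ℂ n (n + j)) (n + j)
            (partitionWeightLex (n + j) (rowLift μ j)) := by
  intro n j δ _ _ μ hμ D F hF A e₀ hiso hdet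
  -- the `F_i` are forms of degree `δ` (the weight `μ*` pins the degree)
  have hhom : ∀ i, (F i).IsHomogeneous δ := fun i =>
    isHomogeneous_of_mem_highestWeightSpace (NeZero.ne n) (hF i) (size_partitionWeightLex' μ hμ)
  refine ii_twistedInheritance n j δ μ hμ D F hF A ?_
  -- the twisted matrix is the untwisted one with column `l` scaled by `c_l ^ δ`
  have key : (Matrix.of fun i l : Fin D => MvPolynomial.aeval
            (fun e : DegIdx (MatIdx n) n =>
              (((e.1 (topMatIdx n) + j).descFactorial j : ℕ) : ℂ) *
                MvPolynomial.coeff e.1 (linSubst (MatIdx n) ℂ (A l) (paddedPerFormLex ℂ n n)))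
            (F i)) =
      Matrix.of fun i l : Fin D => ((((e₀ l + j).descFactorial j : ℕ) : ℂ) ^ δ) *
        MvPolynomial.aeval (fun e : DegIdx (MatIdx n) n =>
          MvPolynomial.coeff e.1 (linSubst (MatIdx n) ℂ (A l) (paddedPerFormLex ℂ n n))) (F i) := by
    ext i l
    simp only [Matrix.of_apply]
    exact aeval_twist_eq_pow_mul_of_isobaric j (hhom i) (hiso l)
  rw [key, Matrix.det_mul_row]
  refine mul_ne_zero ?_ hdet
  refine Finset.prod_ne_zero_iff.mpr fun l _ => pow_ne_zero _ ?_
  -- `(e₀ l + j).descFactorial j ≠ 0` since `j ≤ e₀ l + j`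
  have hc : (e₀ l + j).descFactorial j ≠ 0 := by
    rw [Ne, Nat.descFactorial_eq_zero_iff_lt]
    omega
  exact_mod_cast hc

end

end Summit.ValiantsHypothesis.ValiantsHypothesis.Theorems.TailFlip
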